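import Summits.QuantumFields.YangMills.Theorems.BalabanUVNodesN22KnitDiscrete

/-!
# BalabanUVNodes ∕ N22 knit, FINITE TOWER — node N22 at run length `K` from node N18 (`T4OutputRate.NE5`) at the run lengths BELOW `K`
# only (a finite datum), plus prefix dependence and the vertex-free second-difference letter (R₂) (Track A, DAG node N22; cluster K4)

HONEST FRAMING.  Count-neutral kernel bookkeeping over hypothesis shapes on ne9's tower of carriers `TowerCarriers.TowerData`; NOT a node
discharge; NE5 ∕ NE9 NOT IN PRINT, NOT PROVED; instance on Bałaban's `E^{(j)}` 0∕1 (W1); one finite four-torus programme at fixed ε; nothing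
continuum ∕ ℝ⁴ ∕ OS ∕ mass-gap ∕ Clay.  0 `sorry`, 0 `def`, standard axioms.  `--supports` item `SpineGivenEndpoint`.

WHY.  `BalabanUVNodesN22Knit.oscFading_of_towerNE5` and `…Discrete.towerNE9_fadingMemory_of_towerNE5_secondDiff` take `TowerNE5 T E γ κ θ C₅`
— `NE5` at EVERY pair of consecutive run lengths `k, k + 1`, all `k : ℕ`.  A record of Bałaban's run with `K` steps is a FINITE datum: it has
the pairs `k' < K` and no others (ne9's `TowerCarriers` §1 «finite towers extend» concerns the abstract sequence, not the record).  The proof of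
the oscillation fading at level `k` only ever peels DOWN from `k`, so the honest in-edge is node N18 at the levels BELOW `k`:
* §1 `oscFading_of_ne5_below` — `∀ k' < k, ∀ b ∈ ]0, γ], NE5 (E k') (E (k'+1) ∘ prepend b) (Window γ) κ θ C₅` on the level carriers
  (`C₅ ≥ 0`, `0 ≤ θ < 1`) ⟹ (O) for `E k`: histories agreeing at indices `≥ a ≤ k − r X` give terms within `(2C₅∕(1−θ))·θ^{(k − r X) − a}·e^{−κd(X)}`
  (the same peeling: `extendTower_rate` + `MemoryFromRate.osc_le_of_towerRate`, the one-step rate inlined from the finite family).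
* §2 `ne9_fadingMemory_at_level_of_ne5_below` — with (P) and the second-difference letter (R₂) of `…N22KnitDiscrete` for `E k`
  (constants `M·μ^{age−1}·e^{−κd}`, step ratio `ρ`, rate `τ`, `θ ≤ τρ`, `μρ ≤ τ`):
  **`NE9 (C := T.level k) (E k) (Window γ) κ Λ₁ ∧ FadingMemory C₉ τ Λ₁`**, `C₉ = (4·(2C₅∕(1−θ))∕γ + Mγ∕2)∕τ` — node N22 for the run of
  length `k` from node N18 at the run lengths `< k` only.  (The C^{1,1} letter (R) of module 1 works the same way via
  `N22Knit.ne9_and_fadingMemory_of_osc_growingSmooth`: `ne9_fadingMemory_at_level_of_ne5_below_smooth`.)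

References (TYPES only): [Balaban1987RG1] = T. Bałaban, Commun. Math. Phys. **109** (1987) 249–301 — Thm 1 p. 259 (window; uniformity in the
lattice spacing), (1.18) p. 263, p. 256 ∕ p. 298 (history dependence).
-/

noncomputable section

namespace Summit.QuantumFields.YangMills.BalabanUVNodes.N22KnitFiniteTower

open Set
open scoped BigOperators
open Literature.MathematicalPhysics.QuantumFieldTheory.Balaban1983to89
open Literature.MathematicalPhysics.QuantumFieldTheory.Balaban1983to89.T4OutputRate
open Summit.QuantumFields.BalabanUV.T4Continuum.NE9.MemoryFromRate (osc_le_of_towerRate shift_mem_window)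
open Summit.QuantumFields.BalabanUV.T4Continuum.NE9.TowerCarriers
  (TowerData extendTower extendTower_rate extendTower_of_le prepend prepend_head_tail)
open Summit.QuantumFields.YangMills.BalabanUVNodes.N22Knit (fadingMemory_geometric ne9_and_fadingMemory_of_osc_growingSmooth)
open Summit.QuantumFields.YangMills.BalabanUVNodes.N22KnitDiscrete (ne9_and_fadingMemory_of_osc_secondDiff)

variable (T : TowerData) {E : ℕ → (ℕ → ℝ) → T.B → T.Dom → ℝ}

/-! ## §1 Oscillation fading at level `k` from NE5 at the levels below `k` -/

/-- **NE5 BELOW LEVEL `k` ⇒ OSCILLATION FADING (O) AT LEVEL `k`.**  On ne9's tower of carriers, if `T4OutputRate.NE5` holds for the pairs of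
run lengths `k', k' + 1` with `k' < k` (run `k' + 1`'s unpaired bare coupling `b ∈ ]0, γ]` a parameter; `C₅ ≥ 0`, `0 ≤ θ < 1`), then two admissible
histories agreeing at every index `≥ a`, `a ≤ k − r X`, give level-`k` terms within `(2C₅∕(1−θ))·θ^{(k − r X) − a}·e^{−κd(X)}`. [folklore] -/
theorem oscFading_of_ne5_below {γ κ θ C₅ : ℝ} (hC : 0 ≤ C₅) (hθ0 : 0 ≤ θ) (hθ1 : θ < 1) (k : ℕ)
    (h5 : ∀ k' : ℕ, k' < k → ∀ b : ℝ, 0 < b → b ≤ γ →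
      NE5 (C := T.level k') (E k') (fun g U X => E (k' + 1) (prepend b g) U X) (Window γ) κ θ C₅) :
    ∀ g ∈ Window γ, ∀ g' ∈ Window γ, ∀ (U : (T.level k).BgA) (X : (T.level k).Dom) (a : ℕ), a ≤ (T.level k).scale X →
      (∀ n, a ≤ n → g n = g' n) →
      |E k g U X - E k g' U X| ≤ 2 * C₅ / (1 - θ) * θ ^ ((T.level k).scale X - a) * Real.exp (-(κ * (T.level k).d X)) := by
  intro g hg g' hg' U X a ha hagree
  change a ≤ k - T.r X at ha
  show |E k g U X - E k g' U X| ≤ 2 * C₅ / (1 - θ) * θ ^ (k - T.r X - a) * Real.exp (-(κ * T.d X))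
  rcases Nat.eq_zero_or_pos a with ha0 | ha0
  · -- nothing to peel: the histories coincide
    subst ha0
    have hgg : g = g' := funext fun n => hagree n (Nat.zero_le n)
    rw [hgg, sub_self, abs_zero]
    have h1θ : 0 < 1 - θ := by linarith
    positivity
  · -- `a ≥ 1`, so `r X < k`: the section of the tower at `(k, U, X)` below the top level `m₀ = k − r X`
    have hX : T.r X ≤ k := by omega
    set m₀ := k - T.r X with hm₀
    set F₀ : ℕ → (ℕ → ℝ) → ℝ :=
      fun m g => Real.exp (κ * T.d X) * E (T.r X + m) g (T.descend k U (T.r X + m)) X with hF₀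
    have hpos : 0 < Real.exp (κ * T.d X) := Real.exp_pos _
    have hT : ∀ m, ∀ g ∈ Window γ,
        |extendTower m₀ F₀ (m + 1) g - extendTower m₀ F₀ m (fun i => g (i + 1))| ≤ C₅ * θ ^ m := by
      refine extendTower_rate hC hθ0 fun m hm g hg => ?_
      have hn : T.r X + m < k := by omega
      -- the one-step rate at the level `r X + m < k` (inline form of `TowerCarriers.rate_of_towerNE5`)
      have hrate : |E (T.r X + m + 1) g (T.descend k U (T.r X + m + 1)) X
          - E (T.r X + m) (fun i => g (i + 1)) (T.tr (T.r X + m) (T.descend k U (T.r X + m + 1))) X|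
          ≤ C₅ * θ ^ (T.r X + m - T.r X) * Real.exp (-(κ * T.d X)) := by
        have h : |E (T.r X + m) (fun i => g (i + 1)) (T.tr (T.r X + m) (T.descend k U (T.r X + m + 1))) X
            - E (T.r X + m + 1) (prepend (g 0) fun i => g (i + 1)) (T.descend k U (T.r X + m + 1)) X|
            ≤ C₅ * θ ^ (T.r X + m - T.r X) * Real.exp (-(κ * T.d X)) :=
          h5 (T.r X + m) hn (g 0) (hg 0).1 (hg 0).2 _ (shift_mem_window hg) (T.descend k U (T.r X + m + 1)) X
        rw [prepend_head_tail] at h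
        rwa [abs_sub_comm]
      rw [T.tr_descend hn, Nat.add_sub_cancel_left] at hrate
      have e : F₀ (m + 1) g - F₀ m (fun i => g (i + 1)) = Real.exp (κ * T.d X) *
          (E (T.r X + m + 1) g (T.descend k U (T.r X + m + 1)) X -
            E (T.r X + m) (fun i => g (i + 1)) (T.descend k U (T.r X + m)) X) := by
        rw [hF₀, ← mul_sub]
        rfl
      rw [e, abs_mul, abs_of_pos hpos]
      calc Real.exp (κ * T.d X) * |E (T.r X + m + 1) g (T.descend k U (T.r X + m + 1)) X -
              E (T.r X + m) (fun i => g (i + 1)) (T.descend k U (T.r X + m)) X|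
          ≤ Real.exp (κ * T.d X) * (C₅ * θ ^ m * Real.exp (-(κ * T.d X))) :=
            mul_le_mul_of_nonneg_left hrate hpos.le
        _ = C₅ * θ ^ m := by rw [Real.exp_neg]; field_simp
    -- peel the `a` oldest couplings at the top level `m₀ = (m₀ − a) + a`
    have hosc := osc_le_of_towerRate (F := extendTower m₀ F₀) hC hθ0 hθ1 (fun g hg => shift_mem_window hg) hT
      (a := a) (m := m₀ - a) hg hg' hagree
    rw [Nat.sub_add_cancel ha, extendTower_of_le F₀ le_rfl, extendTower_of_le F₀ le_rfl] at hosc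
    have etop : ∀ h : ℕ → ℝ, F₀ m₀ h = Real.exp (κ * T.d X) * E k h U X := fun h => by
      simp only [hF₀]
      rw [show T.r X + m₀ = k by omega, T.descend_top]
    rw [etop, etop, ← mul_sub, abs_mul, abs_of_pos hpos] at hosc
    -- divide by `e^{κd(X)}`
    have h1θ : 0 < 1 - θ := by linarith
    rw [Real.exp_neg]
    have key : |E k g U X - E k g' U X| ≤ 2 * C₅ * θ ^ (m₀ - a) / (1 - θ) / Real.exp (κ * T.d X) := by
      rw [le_div_iff₀ hpos, mul_comm]
      exact hosc
    calc |E k g U X - E k g' U X| ≤ 2 * C₅ * θ ^ (m₀ - a) / (1 - θ) / Real.exp (κ * T.d X) := key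
      _ = 2 * C₅ / (1 - θ) * θ ^ (m₀ - a) * (Real.exp (κ * T.d X))⁻¹ := by ring


/-! ## §2 Node N22 at level `k` from node N18 below `k` -/

/-- **NODE N22 FOR THE RUN OF LENGTH `k` FROM NODE N18 AT THE RUN LENGTHS `< k`, second-difference letter.**  NE5 below `k` (§1), prefix
dependence of `E k` and the vertex-free letter (R₂) for `E k` (second differences of each young-coupling section on `]0, γ]` bounded by
`M·μ^{(k − r X) − 1 − i}·e^{−κd(X)}·d²`), with `ρ ∈ ]0, 1]`, `τ > 0`, `θ ≤ τρ`, `μρ ≤ τ`: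
`NE9 (C := T.level k) (E k) (Window γ) κ Λ₁ ∧ FadingMemory C₉ τ Λ₁`, `Λ₁ k i = C₉·τ^{k−i}`, `C₉ = (4·(2C₅∕(1−θ))∕γ + Mγ∕2)∕τ`. [folklore] -/
theorem ne9_fadingMemory_at_level_of_ne5_below {γ κ θ C₅ M μ ρ τ : ℝ} (hC : 0 ≤ C₅) (hθ0 : 0 ≤ θ) (hθ1 : θ < 1) (k : ℕ)
    (h5 : ∀ k' : ℕ, k' < k → ∀ b : ℝ, 0 < b → b ≤ γ →
      NE5 (C := T.level k') (E k') (fun g U X => E (k' + 1) (prepend b g) U X) (Window γ) κ θ C₅)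
    (hP : PrefixDependenceOn (C := T.level k) (E k) (Window γ))
    (hR2 : ∀ g ∈ Window γ, ∀ (U : (T.level k).BgA) (X : (T.level k).Dom) (i : ℕ), i < (T.level k).scale X →
      ∀ t d : ℝ, 0 < d → t - d ∈ Ioc (0 : ℝ) γ → t + d ∈ Ioc (0 : ℝ) γ →
        |E k (Function.update g i (t + d)) U X - 2 * E k (Function.update g i t) U X + E k (Function.update g i (t - d)) U X| ≤
          M * μ ^ ((T.level k).scale X - 1 - i) * Real.exp (-(κ * (T.level k).d X)) * d ^ 2)
    (hM : 0 ≤ M) (hμ : 0 ≤ μ) (hγ : 0 < γ) (hρ0 : 0 < ρ) (hρ1 : ρ ≤ 1) (hθτρ : θ ≤ τ * ρ) (hμρτ : μ * ρ ≤ τ) (hτ0 : 0 < τ) :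
    NE9 (C := T.level k) (E k) (Window γ) κ (fun k i => (4 * (2 * C₅ / (1 - θ)) / γ + M * γ / 2) / τ * τ ^ (k - i)) ∧
      FadingMemory ((4 * (2 * C₅ / (1 - θ)) / γ + M * γ / 2) / τ) τ
        (fun k i => (4 * (2 * C₅ / (1 - θ)) / γ + M * γ / 2) / τ * τ ^ (k - i)) := by
  have h1θ : 0 < 1 - θ := by linarith
  have hC₀ : 0 ≤ 2 * C₅ / (1 - θ) := by positivity
  exact ne9_and_fadingMemory_of_osc_secondDiff (C := T.level k) hP (oscFading_of_ne5_below T hC hθ0 hθ1 k h5) hR2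
    hC₀ hθ0 hM hμ hγ hρ0 hρ1 hθτρ hμρτ hτ0

/-- **NODE N22 FOR THE RUN OF LENGTH `k` FROM NODE N18 AT THE RUN LENGTHS `< k`, C^{1,1} letter.**  The same with module 1's letter (R):
the young-coupling sections of `E k` differentiable within `[0, γ]` with `M·μ^{age−1}·e^{−κd}`-Lipschitz derivatives;
`C₉ = (2·(2C₅∕(1−θ))∕γ + Mγ∕2)∕τ`. [folklore] -/
theorem ne9_fadingMemory_at_level_of_ne5_below_smooth {γ κ θ C₅ M μ ρ τ : ℝ} (hC : 0 ≤ C₅) (hθ0 : 0 ≤ θ) (hθ1 : θ < 1) (k : ℕ)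
    (h5 : ∀ k' : ℕ, k' < k → ∀ b : ℝ, 0 < b → b ≤ γ →
      NE5 (C := T.level k') (E k') (fun g U X => E (k' + 1) (prepend b g) U X) (Window γ) κ θ C₅)
    (hP : PrefixDependenceOn (C := T.level k) (E k) (Window γ))
    (hR : ∀ g ∈ Window γ, ∀ (U : (T.level k).BgA) (X : (T.level k).Dom) (i : ℕ), i < (T.level k).scale X → ∃ f' : ℝ → ℝ,
      (∀ t ∈ Icc (0 : ℝ) γ, HasDerivWithinAt (fun t : ℝ => E k (Function.update g i t) U X) (f' t) (Icc (0 : ℝ) γ) t) ∧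
      ∀ s ∈ Icc (0 : ℝ) γ, ∀ t ∈ Icc (0 : ℝ) γ,
        |f' s - f' t| ≤ M * μ ^ ((T.level k).scale X - 1 - i) * Real.exp (-(κ * (T.level k).d X)) * |s - t|)
    (hM : 0 ≤ M) (hμ : 0 ≤ μ) (hγ : 0 < γ) (hρ0 : 0 < ρ) (hρ1 : ρ ≤ 1) (hθτρ : θ ≤ τ * ρ) (hμρτ : μ * ρ ≤ τ) (hτ0 : 0 < τ) :
    NE9 (C := T.level k) (E k) (Window γ) κ (fun k i => (2 * (2 * C₅ / (1 - θ)) / γ + M * γ / 2) / τ * τ ^ (k - i)) ∧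
      FadingMemory ((2 * (2 * C₅ / (1 - θ)) / γ + M * γ / 2) / τ) τ
        (fun k i => (2 * (2 * C₅ / (1 - θ)) / γ + M * γ / 2) / τ * τ ^ (k - i)) := by
  have h1θ : 0 < 1 - θ := by linarith
  have hC₀ : 0 ≤ 2 * C₅ / (1 - θ) := by positivity
  exact ne9_and_fadingMemory_of_osc_growingSmooth (C := T.level k) hP (oscFading_of_ne5_below T hC hθ0 hθ1 k h5) hR
    hC₀ hθ0 hM hμ hγ hρ0 hρ1 hθτρ hμρτ hτ0

end Summit.QuantumFields.YangMills.BalabanUVNodes.N22KnitFiniteTower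

end
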